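import Literature.Analysis.FluidPDE.KernelIntegralSmooth
import Literature.Analysis.FluidPDE.NormalisedPressureBilinear
import HarnessLib

/-!
# The off-support part of the local pressure: smoothness with all-orders bounds, and the
# principal-value algebra `p̃[w] = p̃[a] + Q[w − a, w + a]` near a ball where `w = a`

Analysis/FluidPDE support file (everything proved, no definitions, no named facts) on the proof
path of the named fact `Literature.Analysis.FluidPDE.jia_sverak_2014_local_higher_regularity`
(`JiaSverak2014LocalRegularity.lean`; H. Jia, V. Šverák, Invent. Math. 196 (2014) =
arXiv:1204.0529, §4 proof of Thm. 4.1, bootstrapping of the proof of Thm. 3.2: the local pressure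
`p_loc = p̃[1_{B}u]` (formula (3.3)) splits, near a smaller ball where `u` is `C^{k,γ}`, into the
pressure of the smooth part and an integral over the complement, which is harmonic, hence smooth
with bounds, near the smaller ball).

For the tree's symmetric bilinear kernel `B_z(a, c) = pressureForm z a c`
(`K(z)(a) = B_z(a, a)`, `NormalisedPressurePV.lean`) we prove:

* `pressureForm_smul_arg`, `contDiffOn_pressureForm_arg`,
  `exists_norm_iteratedFDeriv_pressureForm_le` — the basis kernels `κᵢⱼ(z) = B_z(bᵢ, bⱼ)` are
  homogeneous of degree `−3`, smooth off the origin, with `‖Dᵐκᵢⱼ(z)‖ ≤ C(m)|z|^{−3−m}`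
  (`KernelIntegralSmooth.exists_norm_iteratedFDeriv_le_of_homogeneous`);
* `pressureForm_apply_eq_sum_smul` — `B_z(c(y), d(y)) = Σᵢⱼ cᵢ(y)dⱼ(y) κᵢⱼ(z)`;
* `contDiffOn_offSupportPressure`, `exists_norm_iteratedFDeriv_offSupportPressure_le` — **the
  off-support bilinear pressure `Q(x) = ∫ B_{x−y}(c(y), d(y)) dy` of fields with `|c||d| ∈ L¹` and
  `c = 0` on `B(x₀, ρ)` is `C^∞` on `B(x₀, ρ')`, `ρ' < ρ`, with
  `‖DᵐQ(x)‖ ≤ C(m, ρ − ρ') ∫|c||d|`** (all-orders differentiation under the integral sign,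
  `KernelIntegralSmooth.lean`);
* `normalisedPressure_eq_add_integral_ae` — **the principal-value algebra**: if `w, a` are
  measurable with `|w|², |a|² ∈ L^{3/2}` and `w = a` on `B(x₀, ρ)`, then for a.e. `x ∈ B(x₀, ρ)`,
  `p̃[w](x) = p̃[a](x) + ∫ B_{x−y}(w(y) − a(y), w(y) + a(y)) dy` (both principal values exist a.e.
  by the tree's Calderón–Zygmund theory `ae_exists_hasPressurePV`; their difference is the limit of
  the truncated integrals of `B(w − a, w + a)`, which are eventually constant since the integrand
  vanishes near `x`).

## Mathlib / tree search

Tree (used): `pressureForm` and its algebra (`pressureForm_symm/add/smul/sum/zero_left`,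
`pressureForm_eq_polarisation`, `pressureForm_apply_eq_sum`, `abs_pressureForm_le`),
`truncatedPressureIntegral_sub_eq`, `normalisedPressure_sub_eq`,
`integrableOn_pressureKernel_of_memLp`, `integrableOn_pressureForm_of_memLp`,
`memLp_norm_sub_mul_norm_add`-type bounds, `ae_exists_hasPressurePV` (`NormalisedPressureBilinear`,
`LocalLerayPressureDecompositionProofs`); `contDiffOn_integral_kernel`,
`norm_iteratedFDeriv_integral_kernel_le`, `exists_norm_iteratedFDeriv_le_of_homogeneous`
(`KernelIntegralSmooth`). Mathlib: `contDiffAt_norm`, `iteratedFDeriv_fun_sum_apply`,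
`iteratedFDeriv_const_smul_apply'`, `iteratedFDeriv_comp_sub`.

## References

* H. Jia, V. Šverák, Invent. Math. 196 (2014) = arXiv:1204.0529, §3 (3.3), §4 proof of Thm. 4.1.
  Bib key `JiaSverak2014`.
* K. Kang, H. Miura, T.-P. Tsai, IMRN 2021 = arXiv:1812.10509, Lemma 3.4. Bib key
  `KangMiuraTsai2020`.
* E. M. Stein, *Singular integrals and differentiability properties of functions* (1970), Ch. II
  §4.5 Thm. 4. Bib key `Stein1971`.
-/

noncomputable section

open MeasureTheory Set Filter Topology Function Metric
open scoped ENNReal NNReal RealInnerProductSpace ContDiff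

namespace Literature.Analysis.FluidPDE

/-- Local notation for physical space `ℝ³ = EuclideanSpace ℝ (Fin 3)`. -/
local notation "ℝ³" => EuclideanSpace ℝ (Fin 3)

/-- Local notation for the orthonormal basis of the coordinate expansions (`coord`). -/
local notation "𝔟" => stdOrthonormalBasis ℝ (EuclideanSpace ℝ (Fin 3))

/-! ### The basis kernels `κᵢⱼ(z) = B_z(bᵢ, bⱼ)` -/

/-- **Homogeneity of degree `−3`**: `B_{cz}(a, e) = c⁻³ B_z(a, e)` for `c > 0`. [folklore] -/
theorem pressureForm_smul_arg {c : ℝ} (hc : 0 < c) (z a e : ℝ³) :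
    pressureForm (c • z) a e = c ^ (-3 : ℤ) • pressureForm z a e := by
  by_cases hz : z = 0
  · subst hz
    simp [pressureForm]
  have hzn : 0 < ‖z‖ := norm_pos_iff.2 hz
  simp only [pressureForm, real_inner_smul_left, norm_smul, Real.norm_eq_abs, abs_of_pos hc,
    smul_eq_mul, zpow_neg, zpow_ofNat]
  field_simp

/-- **Smoothness off the origin** of `z ↦ B_z(a, e)` (a rational function of `z` with denominator
`4π|z|⁵`). [folklore] -/
theorem contDiffOn_pressureForm_arg (a e : ℝ³) : ContDiffOn ℝ ∞ (fun z => pressureForm z a e) {0}ᶜ := by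
  intro z hz
  have hz' : z ≠ 0 := hz
  have hnum : ContDiff ℝ ∞ fun z : ℝ³ => 3 * ⟪z, a⟫ * ⟪z, e⟫ - ⟪a, e⟫ * ‖z‖ ^ 2 :=
    ((contDiff_const.mul (contDiff_id.inner ℝ contDiff_const)).mul
      (contDiff_id.inner ℝ contDiff_const)).sub (contDiff_const.mul (contDiff_norm_sq ℝ))
  have hden : ContDiffAt ℝ ∞ (fun z : ℝ³ => 4 * Real.pi * ‖z‖ ^ 5) z :=
    contDiffAt_const.mul ((contDiffAt_norm ℝ hz').pow 5)
  have hne : 4 * Real.pi * ‖z‖ ^ 5 ≠ 0 :=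
    mul_ne_zero (by positivity) (pow_ne_zero 5 (norm_ne_zero_iff.2 hz'))
  have h : ContDiffAt ℝ ∞ (fun z => pressureForm z a e) z := by
    have := hnum.contDiffAt.div hden hne
    exact this.congr_of_eventuallyEq (Eventually.of_forall fun w => rfl)
  exact h.contDiffWithinAt

/-- **All-orders decay of the basis kernels**: for every `m` there is `C ≥ 0` with
`‖Dᵐκᵢⱼ(z)‖ ≤ C |z|^{−3−m}` for all `i, j` and `z ≠ 0`. [folklore] -/
theorem exists_norm_iteratedFDeriv_pressureForm_le (m : ℕ) :
    ∃ C : ℝ, 0 ≤ C ∧ ∀ (i j : Fin (Module.finrank ℝ ℝ³)) (z : ℝ³), z ≠ 0 →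
      ‖iteratedFDeriv ℝ m (fun z => pressureForm z (𝔟 i) (𝔟 j)) z‖ ≤ C * ‖z‖ ^ ((-3 : ℤ) - m) := by
  have h : ∀ i j : Fin (Module.finrank ℝ ℝ³), ∃ C : ℝ, 0 ≤ C ∧ ∀ z : ℝ³, z ≠ 0 →
      ‖iteratedFDeriv ℝ m (fun z => pressureForm z (𝔟 i) (𝔟 j)) z‖ ≤ C * ‖z‖ ^ ((-3 : ℤ) - m) := fun i j =>
    exists_norm_iteratedFDeriv_le_of_homogeneous (fun z => pressureForm z (𝔟 i) (𝔟 j)) (-3)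
      (fun c hc z => pressureForm_smul_arg hc z _ _) (contDiffOn_pressureForm_arg _ _) m
  choose C hC0 hC using h
  refine ⟨∑ i, ∑ j, C i j, Finset.sum_nonneg fun i _ => Finset.sum_nonneg fun j _ => hC0 i j,
    fun i j z hz => (hC i j z hz).trans ?_⟩
  have hz0 : 0 ≤ ‖z‖ ^ ((-3 : ℤ) - m) := zpow_nonneg (norm_nonneg _) _
  refine mul_le_mul_of_nonneg_right ?_ hz0
  calc C i j ≤ ∑ j', C i j' := Finset.single_le_sum (fun j' _ => hC0 i j') (Finset.mem_univ j)
    _ ≤ ∑ i', ∑ j', C i' j' :=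
        Finset.single_le_sum (f := fun i' => ∑ j', C i' j') (fun i' _ => Finset.sum_nonneg fun j' _ => hC0 i' j')
          (Finset.mem_univ i)

/-- `|z|^{−3−m} ≤ δ^{−3−m}` for `|z| ≥ δ > 0`. [folklore] -/
theorem norm_zpow_neg_le {z : ℝ³} {δ : ℝ} (hδ : 0 < δ) (hz : δ ≤ ‖z‖) (m : ℕ) :
    ‖z‖ ^ ((-3 : ℤ) - m) ≤ (δ ^ (3 + m))⁻¹ := by
  have hzp : 0 < ‖z‖ := hδ.trans_le hz
  rw [show ((-3 : ℤ) - m) = -((3 + m : ℕ) : ℤ) by push_cast; ring, zpow_neg, zpow_natCast]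
  exact inv_anti₀ (pow_pos hδ _) (pow_le_pow_left₀ hδ.le hz _)

/-! ### Expansion of the bilinear kernel along the basis -/

/-- The coordinates are bounded by the norm: `|cᵢ(y)| ≤ ‖c(y)‖`. [folklore] -/
theorem abs_coord_le (c : ℝ³ → ℝ³) (i : Fin (Module.finrank ℝ ℝ³)) (y : ℝ³) : |coord c i y| ≤ ‖c y‖ := by
  rw [coord]
  have h := abs_real_inner_le_norm (c y) (𝔟 i)
  rwa [(𝔟).orthonormal.1 i, mul_one] at h

/-- **`B_z(c(y), d(y)) = Σᵢⱼ cᵢ(y) dⱼ(y) κᵢⱼ(z)`** (bilinearity along the orthonormal basis; the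
tree's `pressureForm_apply_eq_sum` with the polarised kernel rewritten as `B_z(bᵢ, bⱼ)`). [folklore] -/
theorem pressureForm_apply_eq_sum_smul (z : ℝ³) (c d : ℝ³ → ℝ³) (y : ℝ³) :
    pressureForm z (c y) (d y) = ∑ i, ∑ j, (coord c i y * coord d j y) • pressureForm z (𝔟 i) (𝔟 j) := by
  rw [pressureForm_apply_eq_sum]
  refine Finset.sum_congr rfl fun i _ => Finset.sum_congr rfl fun j _ => ?_
  rw [smul_eq_mul, pressureForm_eq_polarisation]

/-! ### The off-support bilinear pressure is smooth near the ball, with all-orders bounds -/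

section OffSupport

variable {c d : ℝ³ → ℝ³} {x₀ : ℝ³} {ρ ρ' : ℝ}

/-- On the ball where `c` vanishes the integrand of `Q` vanishes, so `Q` is an integral over the
complement: `∫ B_{x−y}(c y, d y) dy = ∫_{B(x₀,ρ)ᶜ} 1 • B_{x−y}(c y, d y) dy`. [folklore] -/
theorem integral_pressureForm_eq_setIntegral (h0 : ∀ y ∈ ball x₀ ρ, c y = 0) (x : ℝ³) :
    ∫ y, pressureForm (x - y) (c y) (d y) =
      ∫ y, (1 : ℝ) • pressureForm (x - y) (c y) (d y) ∂(volume.restrict (ball x₀ ρ)ᶜ) := by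
  simp only [one_smul]
  refine (setIntegral_eq_integral_of_forall_compl_eq_zero fun y hy => ?_).symm
  rw [mem_compl_iff, not_not] at hy
  rw [h0 y hy, pressureForm_zero_left]

/-- **The off-support bilinear pressure is `C^∞` on the smaller ball, with all-orders bounds.**
For every `m` and radii `ρ' < ρ` there is `C = C(m, ρ, ρ')` such that for all measurable
`c, d : ℝ³ → ℝ³` with `|c||d| ∈ L¹` and `c = 0` on `B(x₀, ρ)`, the function
`Q(x) = ∫ B_{x−y}(c(y), d(y)) dy` is `C^∞` on `B(x₀, ρ')` and `‖DᵐQ(x)‖ ≤ C ∫|c||d|` there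
(all `x`-derivatives of the kernel are bounded by `C(m')(ρ−ρ')^{−3−m'}|c(y)||d(y)|` for
`x ∈ B(x₀, ρ')`, `y ∉ B(x₀, ρ)`; differentiation under the integral sign at all orders).
[cite: JiaSverak2014, §4 proof of Thm. 4.1 (bootstrapping: the pressure generated away from the ball)] -/
theorem exists_offSupportPressure_smooth (m : ℕ) {ρ ρ' : ℝ} (hρ : ρ' < ρ) :
    ∃ C : ℝ, 0 ≤ C ∧ ∀ {c d : ℝ³ → ℝ³} {x₀ : ℝ³}, AEStronglyMeasurable c volume →
      AEStronglyMeasurable d volume → Integrable (fun y => ‖c y‖ * ‖d y‖) volume →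
      (∀ y ∈ ball x₀ ρ, c y = 0) →
        ContDiffOn ℝ ∞ (fun x => ∫ y, pressureForm (x - y) (c y) (d y)) (ball x₀ ρ') ∧
          ∀ x ∈ ball x₀ ρ',
            ‖iteratedFDeriv ℝ m (fun x => ∫ y, pressureForm (x - y) (c y) (d y)) x‖ ≤
              C * ∫ y, ‖c y‖ * ‖d y‖ := by
  -- the kernel constants, all orders at once
  have hK : ∀ m' : ℕ, ∃ C : ℝ, 0 ≤ C ∧ ∀ (i j : Fin (Module.finrank ℝ ℝ³)) (z : ℝ³), z ≠ 0 →
      ‖iteratedFDeriv ℝ m' (fun z => pressureForm z (𝔟 i) (𝔟 j)) z‖ ≤ C * ‖z‖ ^ ((-3 : ℤ) - m') :=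
    fun m' => exists_norm_iteratedFDeriv_pressureForm_le m'
  choose Cκ hCκ0 hCκ using hK
  set δ : ℝ := ρ - ρ' with hδ
  have hδ0 : 0 < δ := sub_pos.2 hρ
  set N : ℕ := Fintype.card (Fin (Module.finrank ℝ ℝ³)) with hN
  set B : ℕ → ℝ := fun m' => (N : ℝ) ^ 2 * Cκ m' * (δ ^ (3 + m'))⁻¹ with hB
  have hB0 : ∀ m', 0 ≤ B m' := fun m' => by have := hCκ0 m'; positivity
  refine ⟨B m, hB0 m, ?_⟩
  intro c d x₀ hcm hdm hI h0
  -- geometry: `x ∈ B(x₀, ρ')`, `y ∉ B(x₀, ρ)` ⇒ `‖x − y‖ ≥ δ`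
  have hdist : ∀ x ∈ ball x₀ ρ', ∀ y ∈ (ball x₀ ρ)ᶜ, δ ≤ ‖x - y‖ := by
    intro x hx y hy
    rw [mem_compl_iff, mem_ball, not_lt, dist_eq_norm] at hy
    rw [mem_ball, dist_eq_norm] at hx
    have : ‖y - x₀‖ ≤ ‖y - x‖ + ‖x - x₀‖ := norm_sub_le_norm_sub_add_norm_sub y x x₀
    rw [norm_sub_rev y x] at this
    linarith
  have hne : ∀ x ∈ ball x₀ ρ', ∀ y ∈ (ball x₀ ρ)ᶜ, x - y ≠ 0 := fun x hx y hy h => by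
    have := hdist x hx y hy
    rw [h, norm_zero] at this
    linarith
  -- the kernel `K(x, y) = B_{x−y}(c y, d y)` and its `x`-derivatives
  set S : Set ℝ³ := (ball x₀ ρ)ᶜ with hS
  set U : Set ℝ³ := ball x₀ ρ' with hU
  set μ : Measure ℝ³ := volume.restrict S with hμ
  have hSmeas : MeasurableSet S := measurableSet_ball.compl
  have hSae : ∀ᵐ y ∂μ, y ∈ S := ae_restrict_mem hSmeas
  -- smoothness in `x` of each basis kernel translate, on `U`, for `y ∈ S`
  have hκat : ∀ (i j : Fin (Module.finrank ℝ ℝ³)), ∀ x ∈ U, ∀ y ∈ S, ∀ (n : ℕ),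
      ContDiffAt ℝ n (fun x' => pressureForm (x' - y) (𝔟 i) (𝔟 j)) x := by
    intro i j x hx y hy n
    have h1 : ContDiffAt ℝ ∞ (fun z => pressureForm z (𝔟 i) (𝔟 j)) (x - y) :=
      (contDiffOn_pressureForm_arg _ _).contDiffAt (isOpen_compl_singleton.mem_nhds (hne x hx y hy))
    exact ((contDiffAt_infty.1 h1 n).comp x (contDiffAt_id.sub contDiffAt_const))
  -- the expansion of the kernel and of its derivatives
  have hexp : ∀ y x', pressureForm (x' - y) (c y) (d y) =
      ∑ i, ∑ j, (coord c i y * coord d j y) • pressureForm (x' - y) (𝔟 i) (𝔟 j) := fun y x' =>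
    pressureForm_apply_eq_sum_smul (x' - y) c d y
  have hDexp : ∀ (m' : ℕ), ∀ x ∈ U, ∀ y ∈ S,
      iteratedFDeriv ℝ m' (fun x' => pressureForm (x' - y) (c y) (d y)) x =
        ∑ i, ∑ j, (coord c i y * coord d j y) •
          iteratedFDeriv ℝ m' (fun z => pressureForm z (𝔟 i) (𝔟 j)) (x - y) := by
    intro m' x hx y hy
    have hfun : (fun x' => pressureForm (x' - y) (c y) (d y)) =
        fun x' => ∑ i, ∑ j, (coord c i y * coord d j y) • pressureForm (x' - y) (𝔟 i) (𝔟 j) :=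
      funext fun x' => hexp y x'
    rw [hfun, iteratedFDeriv_fun_sum_apply fun i _ => ?_]
    · refine Finset.sum_congr rfl fun i _ => ?_
      rw [iteratedFDeriv_fun_sum_apply fun j _ => ((hκat i j x hx y hy m').const_smul _)]
      refine Finset.sum_congr rfl fun j _ => ?_
      rw [iteratedFDeriv_const_smul_apply' (hκat i j x hx y hy m')]
      congr 1
      exact iteratedFDeriv_comp_sub (f := fun z => pressureForm z (𝔟 i) (𝔟 j)) m' y x
    · exact ContDiffAt.sum fun j _ => (hκat i j x hx y hy m').const_smul _
  -- (h1) smoothness in `x`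
  have h1 : ∀ y ∈ S, ContDiffOn ℝ ∞ (fun x => pressureForm (x - y) (c y) (d y)) U := by
    intro y hy x hx
    have : ContDiffAt ℝ ∞ (fun x' => pressureForm (x' - y) (c y) (d y)) x := by
      rw [show (fun x' => pressureForm (x' - y) (c y) (d y)) =
        fun x' => ∑ i, ∑ j, (coord c i y * coord d j y) • pressureForm (x' - y) (𝔟 i) (𝔟 j) from
        funext fun x' => hexp y x']
      refine contDiffAt_infty.2 fun n => ContDiffAt.sum fun i _ => ContDiffAt.sum fun j _ => ?_
      exact (hκat i j x hx y hy n).const_smul _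
    exact this.contDiffWithinAt
  -- (h2) the weighted bounds
  have h2 : ∀ m' : ℕ, ∀ x ∈ U, ∀ y ∈ S,
      ‖iteratedFDeriv ℝ m' (fun x' => pressureForm (x' - y) (c y) (d y)) x‖ ≤ B m' * (‖c y‖ * ‖d y‖) := by
    intro m' x hx y hy
    rw [hDexp m' x hx y hy]
    have hzy := hne x hx y hy
    have hterm : ∀ i j, ‖(coord c i y * coord d j y) •
        iteratedFDeriv ℝ m' (fun z => pressureForm z (𝔟 i) (𝔟 j)) (x - y)‖ ≤
        ‖c y‖ * ‖d y‖ * (Cκ m' * (δ ^ (3 + m'))⁻¹) := by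
      intro i j
      rw [norm_smul, Real.norm_eq_abs, abs_mul]
      refine mul_le_mul (mul_le_mul (abs_coord_le c i y) (abs_coord_le d j y) (abs_nonneg _) (norm_nonneg _))
        ((hCκ m' i j (x - y) hzy).trans (mul_le_mul_of_nonneg_left
          (norm_zpow_neg_le hδ0 (hdist x hx y hy) m') (hCκ0 m'))) (norm_nonneg _) (by positivity)
    calc ‖∑ i, ∑ j, (coord c i y * coord d j y) • iteratedFDeriv ℝ m' (fun z => pressureForm z (𝔟 i) (𝔟 j)) (x - y)‖
        ≤ ∑ i, ∑ j, ‖c y‖ * ‖d y‖ * (Cκ m' * (δ ^ (3 + m'))⁻¹) := by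
          refine (norm_sum_le _ _).trans (Finset.sum_le_sum fun i _ => ?_)
          exact (norm_sum_le _ _).trans (Finset.sum_le_sum fun j _ => hterm i j)
      _ = B m' * (‖c y‖ * ‖d y‖) := by
          simp only [Finset.sum_const, Finset.card_univ, nsmul_eq_mul, hB, hN]
          ring
  -- (h3) measurability in `y` of the derivatives
  have h3 : ∀ m' : ℕ, ∀ x ∈ U, AEStronglyMeasurable
      (fun y => iteratedFDeriv ℝ m' (fun x' => pressureForm (x' - y) (c y) (d y)) x) μ := by
    intro m' x hx
    have hform : ∀ᵐ y ∂μ, iteratedFDeriv ℝ m' (fun x' => pressureForm (x' - y) (c y) (d y)) x =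
        ∑ i, ∑ j, (coord c i y * coord d j y) •
          iteratedFDeriv ℝ m' (fun z => pressureForm z (𝔟 i) (𝔟 j)) (x - y) := by
      filter_upwards [hSae] with y hy
      exact hDexp m' x hx y hy
    refine (AEStronglyMeasurable.congr ?_ (hform.mono fun y hy => hy.symm))
    refine Finset.aestronglyMeasurable_fun_sum _ fun i _ => Finset.aestronglyMeasurable_fun_sum _ fun j _ => ?_
    have hcoef : AEStronglyMeasurable (fun y => coord c i y * coord d j y) μ :=
      ((hcm.mono_measure Measure.restrict_le_self).inner aestronglyMeasurable_const).mul
        ((hdm.mono_measure Measure.restrict_le_self).inner aestronglyMeasurable_const)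
    have hker : AEStronglyMeasurable
        (fun y => iteratedFDeriv ℝ m' (fun z => pressureForm z (𝔟 i) (𝔟 j)) (x - y)) μ := by
      have hcont : ContinuousOn (iteratedFDeriv ℝ m' fun z => pressureForm z (𝔟 i) (𝔟 j)) {0}ᶜ := by
        have h := (contDiffOn_pressureForm_arg (𝔟 i) (𝔟 j)).continuousOn_iteratedFDerivWithin
          (m := m') (by exact_mod_cast le_top) isOpen_compl_singleton.uniqueDiffOn
        exact h.congr fun z hz => (iteratedFDerivWithin_of_isOpen m' isOpen_compl_singleton hz).symm
      refine ContinuousOn.aestronglyMeasurable ?_ hSmeas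
      exact hcont.comp (continuousOn_const.sub continuousOn_id) fun y hy => hne x hx y hy
    exact hcoef.smul hker
  -- apply the kernel lemmas with `g = 1`, `w = |c||d|`
  have hg : AEStronglyMeasurable (fun _ : ℝ³ => (1 : ℝ)) μ := aestronglyMeasurable_const
  have hw0 : ∀ y, 0 ≤ ‖c y‖ * ‖d y‖ := fun y => by positivity
  have hwg : Integrable (fun y => ‖c y‖ * ‖d y‖ * ‖(1 : ℝ)‖) μ := by
    simpa using hI.restrict (s := S)
  have hfun : (fun x => ∫ y, pressureForm (x - y) (c y) (d y)) =
      fun x => ∫ y, (1 : ℝ) • pressureForm (x - y) (c y) (d y) ∂μ :=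
    funext fun x => integral_pressureForm_eq_setIntegral h0 x
  rw [hfun]
  refine ⟨contDiffOn_infty_integral_kernel isOpen_ball hSae h1 h2 h3 hg hw0 hwg, fun x hx => ?_⟩
  have h := norm_iteratedFDeriv_integral_kernel_le isOpen_ball hSae h1 h2 h3 hg hw0 hwg m hx
  refine h.trans ?_
  rw [abs_of_nonneg (hB0 m)]
  refine mul_le_mul_of_nonneg_left ?_ (hB0 m)
  calc ∫ y, ‖c y‖ * ‖d y‖ * ‖(1 : ℝ)‖ ∂μ = ∫ y in S, ‖c y‖ * ‖d y‖ := by simp [hμ]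
    _ ≤ ∫ y, ‖c y‖ * ‖d y‖ := setIntegral_le_integral hI (Eventually.of_forall hw0)

end OffSupport

/-! ### The principal-value algebra near a ball where the fields agree -/

section PV

variable {w a : ℝ³ → ℝ³} {x₀ : ℝ³} {ρ : ℝ}

/-- **`p̃[w] = p̃[a] + ∫ B(w − a, w + a)` a.e. on a ball where `w = a`.** Let `w, a` be
measurable with `|w|², |a|² ∈ L^{3/2}` and `w = a` on `B(x₀, ρ)`. Then for a.e. `x ∈ B(x₀, ρ)`,
`p̃[w](x) = p̃[a](x) + ∫ B_{x−y}(w(y) − a(y), w(y) + a(y)) dy`, the integral being absolutely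
convergent (its integrand vanishes on `B(x₀, ρ) ∋ x`). Both principal values exist a.e.
(Stein's theorem, the tree's `ae_exists_hasPressurePV`), `p̃[w] − p̃[a] = −(|w|² − |a|²)/3 +
(L_w − L_a)` (`normalisedPressure_sub_eq`), and `L_w − L_a` is the limit of the truncated
integrals of `K(w) − K(a) = B(w − a, w + a)`, eventually equal to the full integral.
[cite: Stein1971, Ch. II §4.5 Thm 4 (a)] [cite: KangMiuraTsai2020, Lemma 3.4 (the split of the local pressure)] -/
theorem normalisedPressure_eq_add_integral_ae (hw : AEStronglyMeasurable w volume)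
    (ha : AEStronglyMeasurable a volume) (hw2 : MemLp (fun y => ‖w y‖ ^ 2) (3 / 2 : ℝ≥0∞) volume)
    (ha2 : MemLp (fun y => ‖a y‖ ^ 2) (3 / 2 : ℝ≥0∞) volume) (heq : ∀ y ∈ ball x₀ ρ, w y = a y) :
    ∀ᵐ x : ℝ³, x ∈ ball x₀ ρ →
      normalisedPressure w x = normalisedPressure a x +
        ∫ y, pressureForm (x - y) (w y - a y) (w y + a y) := by
  have h32_1 : (1 : ℝ≥0∞) < 3 / 2 := by
    rw [ENNReal.lt_div_iff_mul_lt (Or.inl two_ne_zero) (Or.inl ENNReal.ofNat_ne_top)]; norm_num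
  have h32_t : (3 / 2 : ℝ≥0∞) < ⊤ := ENNReal.div_lt_top ENNReal.ofNat_ne_top two_ne_zero
  -- conjugate exponent for the integrability of the truncations
  set q₃ : ℝ≥0∞ := ENNReal.conjExponent (3 / 2 : ℝ≥0∞) with hq₃
  haveI hpq3 : ENNReal.HolderConjugate (3 / 2 : ℝ≥0∞) q₃ := ENNReal.HolderConjugate.conjExponent h32_1.le
  have hq3_1 : 1 < q₃ := (ENNReal.HolderConjugate.lt_top_iff_one_lt (3 / 2 : ℝ≥0∞) q₃).1 h32_t
  have hq3_t : q₃ ≠ ⊤ := (ENNReal.HolderConjugate.ne_top_iff_ne_one q₃ (3 / 2 : ℝ≥0∞)).2 (ne_of_gt h32_1)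
  -- `|w − a||w + a| ∈ L^{3/2}`
  set cf : ℝ³ → ℝ³ := fun y => w y - a y with hcf
  set df : ℝ³ → ℝ³ := fun y => w y + a y with hdf
  have hcfm : AEStronglyMeasurable cf volume := hw.sub ha
  have hdfm : AEStronglyMeasurable df volume := hw.add ha
  have hcd : MemLp (fun y => ‖cf y‖ * ‖df y‖) (3 / 2 : ℝ≥0∞) volume := by
    have hsum : MemLp (fun y => 2 * ‖w y‖ ^ 2 + 2 * ‖a y‖ ^ 2) (3 / 2 : ℝ≥0∞) volume :=
      (hw2.const_mul 2).add (ha2.const_mul 2)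
    refine hsum.of_le (hcfm.norm.mul hdfm.norm) (Eventually.of_forall fun y => ?_)
    rw [Real.norm_eq_abs, Real.norm_eq_abs, abs_of_nonneg (by positivity), abs_of_nonneg (by positivity)]
    have h1 : ‖cf y‖ ≤ ‖w y‖ + ‖a y‖ := norm_sub_le _ _
    have h2 : ‖df y‖ ≤ ‖w y‖ + ‖a y‖ := norm_add_le _ _
    have h' : ‖cf y‖ * ‖df y‖ ≤ (‖w y‖ + ‖a y‖) * (‖w y‖ + ‖a y‖) :=
      mul_le_mul h1 h2 (norm_nonneg _) (by positivity)
    nlinarith [sq_nonneg (‖w y‖ - ‖a y‖)]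
  -- the principal values exist a.e.
  have hPVw := ae_exists_hasPressurePV h32_1 h32_t hw hw2
  have hPVa := ae_exists_hasPressurePV h32_1 h32_t ha ha2
  filter_upwards [hPVw, hPVa] with x hxw hxa hx
  obtain ⟨Lw, hLw⟩ := hxw
  obtain ⟨La, hLa⟩ := hxa
  -- the margin `δ = ρ − dist x x₀ > 0`
  set δ : ℝ := ρ - dist x x₀ with hδ
  have hδ0 : 0 < δ := sub_pos.2 (mem_ball.1 hx)
  have hball : ∀ {ε : ℝ}, ε < δ → closedBall x ε ⊆ ball x₀ ρ := fun {ε} hε y hy => by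
    rw [mem_ball]
    calc dist y x₀ ≤ dist y x + dist x x₀ := dist_triangle _ _ _
      _ ≤ ε + dist x x₀ := by gcongr; exact mem_closedBall.1 hy
      _ < ρ := by linarith
  -- the integrand of the difference vanishes on `B(x₀, ρ)`
  have hzero : ∀ y ∈ ball x₀ ρ, pressureForm (x - y) (cf y) (df y) = 0 := fun y hy => by
    simp only [hcf, heq y hy, sub_self, pressureForm_zero_left]
  -- truncated differences, `0 < ε < δ`: the full integral
  have htrunc : ∀ ε : ℝ, 0 < ε → ε < δ → truncatedPressureIntegral w x ε - truncatedPressureIntegral a x ε =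
      ∫ y, pressureForm (x - y) (cf y) (df y) := by
    intro ε hε hεδ
    have hIw := integrableOn_pressureKernel_of_memLp hq3_1 hq3_t hw hw2 x hε
    have hIa := integrableOn_pressureKernel_of_memLp hq3_1 hq3_t ha ha2 x hε
    rw [truncatedPressureIntegral_sub_eq hIw hIa]
    have e1 : (fun y => pressureForm (x - y) ((w - a) y) ((w + a) y)) = fun y => pressureForm (x - y) (cf y) (df y) := rfl
    rw [e1]
    refine setIntegral_eq_integral_of_forall_compl_eq_zero fun y hy => hzero y (hball hεδ ?_)
    rw [mem_compl_iff, not_not] at hy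
    exact hy
  -- the limit of the truncated differences is `Lw − La`, and also the constant integral
  have hlim1 : Tendsto (fun ε => truncatedPressureIntegral w x ε - truncatedPressureIntegral a x ε) (𝓝[>] 0)
      (𝓝 (Lw - La)) := hLw.2.sub hLa.2
  have hlim2 : Tendsto (fun ε => truncatedPressureIntegral w x ε - truncatedPressureIntegral a x ε) (𝓝[>] 0)
      (𝓝 (∫ y, pressureForm (x - y) (cf y) (df y))) := by
    refine tendsto_const_nhds.congr' ?_
    have hmem : Ioo (0 : ℝ) δ ∈ 𝓝[>] (0 : ℝ) := Ioo_mem_nhdsGT hδ0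
    filter_upwards [hmem] with ε hε
    exact (htrunc ε hε.1 hε.2).symm
  have hL : Lw - La = ∫ y, pressureForm (x - y) (cf y) (df y) := tendsto_nhds_unique hlim1 hlim2
  -- conclude
  have hsub := normalisedPressure_sub_eq hLw hLa
  have hloc : ‖w x‖ ^ 2 - ‖a x‖ ^ 2 = 0 := by rw [heq x hx, sub_self]
  rw [hloc, neg_zero, zero_div, zero_add, hL] at hsub
  linarith

end PV

end Literature.Analysis.FluidPDE

end
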